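import Summits.CriticalPhenomena.Ising3DConformalLimit.Theorems.IsingEuclidUpgradeIsingEuclidUpgradeR2RotInvPowerLawRayProfiles
import Summits.CriticalPhenomena.Ising3DConformalLimit.Theorems.IsingEuclidUpgradeIsingEuclidUpgradeR2RotInvPowerLawTwoDilations
import Literature.Probability.LatticeModels.CriticalTwoPointLawDimension
import HarnessLib

/-!
# Crux `IsingEuclidUpgradeR2RotInvPowerLaw` (stmt-CriticalPhenomena-0634), line `tower_profile_rigidity`:
# the finest lossless split — `r2 ⟺ T1 ∧ D2 ∧ T3 ∧ A_rays`

`G := criticalTwoPoint 3` (critical two-point function of nearest-neighbour Ising on `ℤ³`), `g(n) := G(n e₀)`. With the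
landed glues (TowerRays p166774, RayProfiles p167263, TwoDilations p167268) the crux r2 (isotropic pure power law) is
equivalent to the conjunction of FOUR bare existence-of-limit statements, three about the single axis sequence `g`
and one ray-wise:

* T1 `∃ Δ c > 0, g(2^j)(2^j)^{2Δ} → c` (one tower converges — purity),
* D2 `∃ Δ > 0, g(2n)·4^Δ/g(n) → 1` — VERBATIM item stmt-CriticalPhenomena-6323 `ThresholdDilation.DyadicScalingLaw`,
* T3 `∃ Δ', g(3n)·9^{Δ'}/g(n) → 1` (its triadic twin),
* A_rays `∀ v ≠ 0 ∃ c_v > 0, G(nv)/g(⌊n|v|₂⌋) → c_v` (ray-wise existence of the angular ratio).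

This file proves the converses r2 ⇒ D2, r2 ⇒ T3 at the crux's own exponent (`Δ ∈ [1/2,1]` by the landed window
`twoPointLaw_exponent_mem_Icc`, so `Δ > 0` as item 6323 demands) and assembles the registered
`rotInvPowerLaw_iff_towerLaw_and_scalingLaws_and_rayProfiles`. Refuting any one of the four atoms refutes the crux;
proving all four proves it (`IsingEuclidUpgradeR2RotInvPowerLaw_of_towerLaw_of_dilationLaw_of_rayProfiles` ∘
`integerDilationLaw_of_dyadicScalingLaw_of_triadicScalingLaw`). References: Duminil-Copin, ICM 2022, §8.1
[DuminilCopinICM2022]; Feller II §VIII.8 for the two-dilations step. No definitions.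
-/

noncomputable section

namespace Summit.CriticalPhenomena.Ising3DConformalLimit.Cruxes.IsingEuclidUpgradeR2RotInvPowerLaw.TowerProfileRigidity

open Filter Topology Literature.Probability.LatticeModels
open Summit.CriticalPhenomena.Ising3DConformalLimit.Theorems.IsingEuclidUpgradeR2Split (axis_tendsto_of_tendsto)

/-- **r2 at `(Δ, c)` ⇒ S2 at the SAME `Δ`.** `g(kn)k^{2Δ}/g(n) = [g(kn)(kn)^{2Δ}] / [g(n)n^{2Δ}] → c/c = 1`.
[folklore] -/
theorem dilationLawAt_of_rotInvPowerLawAt {Δ c : ℝ} (hc : 0 < c)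
    (hT : Tendsto (fun x : Site 3 => criticalTwoPoint 3 x * Real.sqrt (∑ i, ((x i : ℝ)) ^ 2) ^ (2 * Δ))
      cofinite (𝓝 c)) :
    ∀ k : ℕ, 1 ≤ k → Tendsto (fun n : ℕ =>
      criticalTwoPoint 3 (Pi.single 0 ((k * n : ℕ) : ℤ)) * (k : ℝ) ^ (2 * Δ) /
        criticalTwoPoint 3 (Pi.single 0 ((n : ℕ) : ℤ))) atTop (𝓝 1) := by
  intro k hk
  have hax := axis_tendsto_of_tendsto hT
  have hk0 : (0 : ℝ) < k := by exact_mod_cast hk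
  have hkmul : Tendsto (fun n : ℕ => k * n) atTop atTop :=
    tendsto_id.const_mul_atTop' (by omega : 0 < k)
  have hnum := hax.comp hkmul
  have hq := hnum.div hax hc.ne'
  rw [div_self hc.ne'] at hq
  refine hq.congr' ?_
  filter_upwards [eventually_ge_atTop 1] with n hn
  show criticalTwoPoint 3 (Pi.single 0 (((k * n : ℕ) : ℕ) : ℤ)) * ((k * n : ℕ) : ℝ) ^ (2 * Δ) /
      (criticalTwoPoint 3 (Pi.single 0 ((n : ℕ) : ℤ)) * (n : ℝ) ^ (2 * Δ)) = _
  have hn0 : (0 : ℝ) < n := by exact_mod_cast hn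
  have hg : criticalTwoPoint 3 (Pi.single 0 ((n : ℕ) : ℤ)) ≠ 0 := (criticalTwoPoint_axis_pos n).ne'
  have hnr : (n : ℝ) ^ (2 * Δ) ≠ 0 := (Real.rpow_pos_of_pos hn0 _).ne'
  rw [show ((k * n : ℕ) : ℝ) = (k : ℝ) * (n : ℝ) by push_cast; ring, Real.mul_rpow hk0.le hn0.le]
  field_simp

/-- **r2 ⇒ D2 (item 6323's dyadic scaling law), with the crux's exponent `Δ ≥ 1/2 > 0`.**
[cite: DuminilCopinICM2022, §8.1] -/
theorem dyadicScalingLaw_of_rotInvPowerLaw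
    (h : Summit.CriticalPhenomena.Ising3DConformalLimit.Theses.IsingEuclidUpgrade.IsingEuclidUpgradeR2RotInvPowerLaw) :
    ∃ Δ : ℝ, 0 < Δ ∧ Filter.Tendsto (fun n : ℕ => Literature.Probability.LatticeModels.criticalTwoPoint 3 (Pi.single 0 ((2 * n : ℕ) : ℤ)) * (4 : ℝ) ^ Δ / Literature.Probability.LatticeModels.criticalTwoPoint 3 (Pi.single 0 ((n : ℕ) : ℤ))) Filter.atTop (nhds 1) := by
  obtain ⟨Δ, c, hc, hT⟩ := h
  have hwin := twoPointLaw_exponent_mem_Icc hc hT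
  refine ⟨Δ, by linarith [hwin.1], ?_⟩
  have h2 := dilationLawAt_of_rotInvPowerLawAt hc hT 2 (by norm_num)
  refine h2.congr fun n => ?_
  have e : ((2 : ℕ) : ℝ) ^ (2 * Δ) = (4 : ℝ) ^ Δ := by
    rw [Nat.cast_ofNat, Real.rpow_mul (by norm_num : (0 : ℝ) ≤ 2)]
    norm_num
  rw [e]

/-- **r2 ⇒ T3 (the triadic scaling law), at the crux's exponent.** [cite: DuminilCopinICM2022, §8.1] -/
theorem triadicScalingLaw_of_rotInvPowerLaw
    (h : Summit.CriticalPhenomena.Ising3DConformalLimit.Theses.IsingEuclidUpgrade.IsingEuclidUpgradeR2RotInvPowerLaw) :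
    ∃ Δ' : ℝ, Filter.Tendsto (fun n : ℕ => Literature.Probability.LatticeModels.criticalTwoPoint 3 (Pi.single 0 ((3 * n : ℕ) : ℤ)) * (9 : ℝ) ^ Δ' / Literature.Probability.LatticeModels.criticalTwoPoint 3 (Pi.single 0 ((n : ℕ) : ℤ))) Filter.atTop (nhds 1) := by
  obtain ⟨Δ, c, hc, hT⟩ := h
  refine ⟨Δ, ?_⟩
  have h3 := dilationLawAt_of_rotInvPowerLawAt hc hT 3 (by norm_num)
  refine h3.congr fun n => ?_
  have e : ((3 : ℕ) : ℝ) ^ (2 * Δ) = (9 : ℝ) ^ Δ := by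
    rw [Nat.cast_ofNat, Real.rpow_mul (by norm_num : (0 : ℝ) ≤ 3)]
    norm_num
  rw [e]

/-- **The finest lossless split (registered name): `r2 ↔ T1 ∧ D2 ∧ T3 ∧ A_rays`.** Forward: the landed converses
`towerLaw_of_rotInvPowerLaw`, `dyadicScalingLaw_of_rotInvPowerLaw`, `triadicScalingLaw_of_rotInvPowerLaw`,
`rayProfiles_of_rotInvPowerLaw`. Backward: D2 ∧ T3 ⇒ S2 (`integerDilationLaw_of_dyadicScalingLaw_of_triadicScalingLaw`,
two dilations suffice), then T1 ∧ S2 ∧ A_rays ⇒ r2 (`IsingEuclidUpgradeR2RotInvPowerLaw_of_towerLaw_of_dilationLaw_of_rayProfiles`).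
[cite: DuminilCopinICM2022, §8.1] -/
theorem rotInvPowerLaw_iff_towerLaw_and_scalingLaws_and_rayProfiles : Summit.CriticalPhenomena.Ising3DConformalLimit.Theses.IsingEuclidUpgrade.IsingEuclidUpgradeR2RotInvPowerLaw ↔ ((∃ Δ c : ℝ, 0 < c ∧ Filter.Tendsto (fun j : ℕ => Literature.Probability.LatticeModels.criticalTwoPoint 3 (Pi.single 0 ((2 ^ j : ℕ) : ℤ)) * ((2 ^ j : ℕ) : ℝ) ^ (2 * Δ)) Filter.atTop (nhds c)) ∧ (∃ Δ : ℝ, 0 < Δ ∧ Filter.Tendsto (fun n : ℕ => Literature.Probability.LatticeModels.criticalTwoPoint 3 (Pi.single 0 ((2 * n : ℕ) : ℤ)) * (4 : ℝ) ^ Δ / Literature.Probability.LatticeModels.criticalTwoPoint 3 (Pi.single 0 ((n : ℕ) : ℤ))) Filter.atTop (nhds 1)) ∧ (∃ Δ' : ℝ, Filter.Tendsto (fun n : ℕ => Literature.Probability.LatticeModels.criticalTwoPoint 3 (Pi.single 0 ((3 * n : ℕ) : ℤ)) * (9 : ℝ) ^ Δ' / Literature.Probability.LatticeModels.criticalTwoPoint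 3 (Pi.single 0 ((n : ℕ) : ℤ))) Filter.atTop (nhds 1)) ∧ (∀ v : Literature.Probability.LatticeModels.Site 3, v ≠ 0 → ∃ c : ℝ, 0 < c ∧ Filter.Tendsto (fun n : ℕ => Literature.Probability.LatticeModels.criticalTwoPoint 3 (((n : ℕ) : ℤ) • v) / Literature.Probability.LatticeModels.criticalTwoPoint 3 (Pi.single 0 ((⌊(n : ℝ) * Real.sqrt (∑ i, ((v i : ℝ)) ^ 2)⌋₊ : ℕ) : ℤ))) Filter.atTop (nhds c))) :=
  ⟨fun h => ⟨towerLaw_of_rotInvPowerLaw h, dyadicScalingLaw_of_rotInvPowerLaw h, triadicScalingLaw_of_rotInvPowerLaw h,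
      rayProfiles_of_rotInvPowerLaw h⟩,
    fun h => IsingEuclidUpgradeR2RotInvPowerLaw_of_towerLaw_of_dilationLaw_of_rayProfiles h.1
      (integerDilationLaw_of_dyadicScalingLaw_of_triadicScalingLaw h.2.1 h.2.2.1) h.2.2.2⟩

end Summit.CriticalPhenomena.Ising3DConformalLimit.Cruxes.IsingEuclidUpgradeR2RotInvPowerLaw.TowerProfileRigidity

end
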